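import Summits.CriticalPhenomena.PercolationContinuityZ3.Theses.PercNearOneGluing
import Literature.Probability.Percolation.PercolationEvents
import HarnessLib.Audit

/-! TTRL-lite variant V2446 of stmt-CriticalPhenomena-4574

(`stub_shorteningStep` of line `kn_shortening_induction`, move `specialise+small_case`:
`n := 4` and `A.card = 4`).  The side conditions are jointly contradictory: a finset
`A : Finset (Fin 4)` with `A.card = 4 = Fintype.card (Fin 4)` is `Finset.univ`, which is
incompatible with `v ∉ A`.  So the statement holds vacuously (compare the sibling variant
V2523, `n ≤ 3 ∧ A.card = 3`).  No new definitions, no named facts, the induction hypothesis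
is not used. -/

namespace Summit.CriticalPhenomena.PercolationContinuityZ3.Theorems

open MeasureTheory Set Literature.Probability.LatticeModels Literature.Probability.Percolation
open scoped Classical BigOperators

/-- TTRL-lite variant V2446 of `stub_shorteningStep` (stmt-CriticalPhenomena-4574, Kozma–Nitzan
shortening step with the induction hypothesis displayed): the inequality
`μ(⋃ a ∈ A, v ↔ a) · μ(a₀ ↔ b) ≤ μ(v ↔ b)` for the glued measure `μ = prodBernoulli (w[s(v,x) ↦ 1])`
on `Fin 4` in the case `A.card = 4`.  Vacuous: `A.card = 4 = Fintype.card (Fin 4)` forces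
`A = univ`, contradicting `v ∉ A`. -/
theorem stub_shorteningStep_var2446 : ∀ (w : Sym2 (Fin 4) → unitInterval) (A : Finset (Fin 4)) (b v x a₀ : Fin 4), A.card = 4 → v ∉ A → v ≠ x → w s(v, x) = 0 → a₀ ∈ A → (∀ a ∈ A, (prodBernoulli w).real (openConn a₀ b) ≤ (prodBernoulli w).real (openConn a b)) → (∀ w' : Sym2 (Fin 4) → unitInterval, (∀ e, w e = 0 → w' e = 0) → ∀ (A' : Finset (Fin 4)) (o' b' : Fin 4) (t : ℝ), (∀ a ∈ A', t ≤ (prodBernoulli w').real (openConn a b')) → (prodBernoulli w').real (⋃ a ∈ A', openConn o' a) * t ≤ (prodBernoulli w').real (openConn o' b')) → (prodBernoulli (Function.update w s(v, x) 1)).real (⋃ a ∈ A, openConn v a) * (prodBernoulli (Function.update w s(v, x) 1)).real (openConn a₀ b) ≤ (prodBernoulli (Function.update w s(v, x) 1)).real (openConn v b) := by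
  intro w A b v x a₀ hcard hv
  -- `A ⊆ Fin 4` has exactly `4 = Fintype.card (Fin 4)` elements, so `A = univ ∋ v`: contradiction
  have hAuniv : A = Finset.univ :=
    Finset.eq_univ_of_card A (by rw [Fintype.card_fin]; exact hcard)
  exact absurd (hAuniv ▸ Finset.mem_univ v) hv

end Summit.CriticalPhenomena.PercolationContinuityZ3.Theorems
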